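import Mathlib.Algebra.QuadraticDiscriminant
import Mathlib.LinearAlgebra.Matrix.BilinearForm
import Literature.Geometry.Lorentzian.KerrSchildMultiplierCurrent
import HarnessLib

/-!
# The dominant energy condition for vector-field multiplier currents in coordinates:
# `∑_μ (J^X)^μ ν_μ ≥ 0` for timelike `X` and causal co-oriented `ν`

(family `gr`; infrastructure for the physical-space multiplier estimates behind statement
**gr.S24** — Dafermos–Rodnianski–Shlapentokh-Rothman, arXiv:1402.7034, §2.3 — in the
coefficient-field framework of `KerrSchild.waveOperator`; namespace
`Literature.Geometry.Lorentzian.KerrSchild`)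

The energy identities of DRSR §2.3.2 are useful because the boundary terms have signs: for a
future timelike multiplier `N` the flux `J^N_μ n^μ` through a spacelike hypersurface with future
normal, and through the (null) event horizon, is non-negative — the dominant energy condition for
the energy–momentum tensor `T_{μν} = ∂_μΨ∂_νΨ − ½ g_{μν} ∂^αΨ∂_αΨ` of a scalar field
(Hawking–Ellis 1973, §4.3; Dafermos–Rodnianski arXiv:0811.0354, App. C–D). The abstract,
manifold-level statement is `LorentzianMetric.stressEnergy_nonneg_of_isTimelike`
(`EnergyCurrents.lean`). This file proves the same inequality for the **coordinate currents**
`KerrSchild.multiplierCurrent G X w` of `KerrSchildMultiplierCurrent.lean`, where the metric enters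
only through the symmetric coefficient field `G = (G^{μν})` (the inverse metric) at the point:

* `KerrSchild.dec_bilin` — the algebraic core: for a symmetric bilinear form `B` on a real vector
  space, covectors `ξ`, `ν`, `p` with `B(ξ, ξ) < 0`, `B` positive semidefinite on `ξ^⊥`
  (Lorentzian or degenerate-Lorentzian signature), `B(ν, ν) ≤ 0` and `B(ξ, ν) < 0` (causal `ν` in
  the cone of `ξ`): `0 ≤ B(ν, p) B(ξ, p) − ½ B(ν, ξ) B(p, p)` — this is `T(ν♯, ξ♯) ≥ 0` with
  `T` the stress–energy form of `p = dw`, proved as in `EnergyCurrents.lean` (decompose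
  `ν = αξ + e`, `p = λξ + u` with `e, u ⊥ ξ`, Cauchy–Schwarz on `ξ^⊥`);
* `KerrSchild.nonneg_on_orthogonal_of_timelike` — the signature hypothesis transfers between
  timelike covectors (`B ≥ 0` on `ξ^⊥` and `B(ξ', ξ') < 0` imply `B ≥ 0` on `ξ'^⊥`: a
  two-dimensional negative definite subspace would meet the hyperplane `ξ^⊥`), so it is a property
  of `G` alone;
* `KerrSchild.sum_multiplierCurrent_mul_eq` — for a multiplier with `X^α(x) = ∑_β G^{αβ}(x) ξ_β`
  (`X = ξ♯`), `∑_μ (J^X)^μ ν_μ = B(ν, p) B(ξ, p) − ½ B(ν, ξ) B(p, p)` with `B = G(x)`, `p = dw(x)`;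
* `KerrSchild.sum_multiplierCurrent_mul_nonneg`, `KerrSchild.neg_sum_multiplierCurrent_mul_nonneg`
  — **the dominant energy condition**: `0 ≤ ∑_μ (J^X)^μ ν_μ` for `ν` causal with `ν(X) < 0`, and
  `0 ≤ −∑_μ (J^X)^μ n_μ` for `n` causal with `n(X) > 0` (e.g. `X` future timelike and
  `n = dt − dF` the conormal of a spacelike or null graph: the *energy* through the graph,
  cf. `Kerr.graphFluxDensity`, and the good sign of horizon / inner-boundary fluxes);
* `KerrSchild.Background.inverseMetric_dt_dt_neg`, `KerrSchild.Background.inverseMetric_nonneg_of_orthogonal_dt`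
  — generalised Kerr–Schild backgrounds (`g⁻¹ = η⁻¹ − φ ℓ♯ ⊗ ℓ♯`, `0 ≤ φ`, `ℓ` null with
  `ℓ(∂_t) = 1`) satisfy the signature hypothesis: `G(dt, dt) = −(1 + φ) < 0` and `G ≥ 0` on
  `dt^⊥` (indeed `G(u, u) ≥ (1 + φ) s²` there, `s = ℓ♯(u)`), so the two inequalities above apply on
  every background, for every timelike multiplier.

## References

* S. W. Hawking, G. F. R. Ellis, *The large scale structure of space-time*, CUP 1973, §4.3 (the
  dominant energy condition for the scalar field) (key `HawkingEllis1973CUP`).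
* M. Dafermos, I. Rodnianski, Y. Shlapentokh-Rothman, arXiv:1402.7034 = Ann. of Math. 183 (2016),
  §2.3.2 (the signs of `J^V_μ n^μ` on `Σ_τ` and `𝓗⁺`) (key `DafermosRodnianskiShlapentokhrothman2014`).
* M. Dafermos, I. Rodnianski, arXiv:0811.0354, App. C–D (key `DafermosRodnianski2008`).
* R. P. Kerr, A. Schild, 1965, §2 (key `KerrSchild1965`).
-/

noncomputable section

open Set Filter
open scoped ContDiff Topology

namespace Literature.Geometry.Lorentzian

namespace KerrSchild

/-! ### The algebraic dominant energy condition for a symmetric bilinear form -/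

section Bilin

variable {V : Type*} [AddCommGroup V] [Module ℝ V]

/-- **Cauchy–Schwarz on the orthogonal complement of a timelike covector**: if `B` is symmetric,
positive semidefinite on `ξ^⊥`, and `u, e ⊥ ξ`, then `B(u, e)² ≤ B(u, u) B(e, e)`.
[folklore] -/
theorem sq_bilin_le_of_orthogonal (B : LinearMap.BilinForm ℝ V) (hB : ∀ u v, B u v = B v u)
    (ξ : V) (hsig : ∀ u, B ξ u = 0 → 0 ≤ B u u) {u e : V} (hu : B ξ u = 0) (he : B ξ e = 0) :
    B u e ^ 2 ≤ B u u * B e e := by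
  have hquad : ∀ t : ℝ, 0 ≤ B e e * (t * t) + 2 * B u e * t + B u u := by
    intro t
    have h := hsig (u + t • e) (by simp [hu, he])
    simp only [map_add, map_smul, LinearMap.add_apply, LinearMap.smul_apply, smul_eq_mul,
      hB e u] at h
    nlinarith [h]
  have hd := discrim_le_zero hquad
  rw [discrim] at hd
  nlinarith [hd]

/-- **The dominant energy condition, algebraic form.** Let `B` be a symmetric bilinear form on a
real vector space which is negative on `ξ` and positive semidefinite on `ξ^⊥` (a Lorentzian, or
degenerate Lorentzian, cone structure with time axis `ξ`), and let `ν` be causal, `B(ν, ν) ≤ 0`,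
in the cone of `ξ`, `B(ξ, ν) < 0`. Then for every `p`,
`0 ≤ B(ν, p) B(ξ, p) − ½ B(ν, ξ) B(p, p)`, i.e. `T[p](ν♯, ξ♯) ≥ 0` for the stress–energy form
`T[p](Y, X) = p(Y) p(X) − ½ g(Y, X) g⁻¹(p, p)` (Hawking–Ellis 1973, §4.3; the proof of
`LorentzianMetric.stressEnergy_nonneg_of_isTimelike` in `EnergyCurrents.lean`, transcribed).
[cite: HawkingEllis1973CUP, §4.3] -/
theorem dec_bilin (B : LinearMap.BilinForm ℝ V) (hB : ∀ u v, B u v = B v u) (ξ ν p : V)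
    (hξ : B ξ ξ < 0) (hsig : ∀ u, B ξ u = 0 → 0 ≤ B u u) (hν : B ν ν ≤ 0) (hco : B ξ ν < 0) :
    0 ≤ B ν p * B ξ p - 2⁻¹ * B ν ξ * B p p := by
  -- notation: `a = B(ξ,ξ) < 0`, `α = B(ν,ξ)/a`, `e = ν − αξ`, `l = B(p,ξ)/a`, `u = p − lξ`
  have ha0 : B ξ ξ ≠ 0 := ne_of_lt hξ
  obtain ⟨a, ha⟩ : ∃ a : ℝ, B ξ ξ = a := ⟨_, rfl⟩
  obtain ⟨α, hα⟩ : ∃ α : ℝ, α = B ν ξ / a := ⟨_, rfl⟩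
  obtain ⟨l, hl⟩ : ∃ l : ℝ, l = B p ξ / a := ⟨_, rfl⟩
  obtain ⟨e, he_def⟩ : ∃ e : V, e = ν - α • ξ := ⟨_, rfl⟩
  obtain ⟨u, hu_def⟩ : ∃ u : V, u = p - l • ξ := ⟨_, rfl⟩
  rw [ha] at hξ ha0
  -- orthogonality
  have he : B ξ e = 0 := by
    rw [he_def, map_sub, map_smul, smul_eq_mul, hB ξ ν, hα, ha]
    field_simp
    ring
  have hu : B ξ u = 0 := by
    rw [hu_def, map_sub, map_smul, smul_eq_mul, hB ξ p, hl, ha]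
    field_simp
    ring
  have heξ : B e ξ = 0 := by rw [hB]; exact he
  have huξ : B u ξ = 0 := by rw [hB]; exact hu
  -- the decompositions
  have hν' : ν = α • ξ + e := by rw [he_def]; abel
  have hp' : p = l • ξ + u := by rw [hu_def]; abel
  have hνξ : B ν ξ = α * a := by
    rw [hν', map_add, map_smul, LinearMap.add_apply, LinearMap.smul_apply, smul_eq_mul, ha, heξ]
    ring
  have hξp : B ξ p = l * a := by
    rw [hp', map_add, map_smul, smul_eq_mul, ha, hu]
    ring
  have hνp : B ν p = α * l * a + B e u := by
    rw [hν', hp']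
    simp only [map_add, map_smul, LinearMap.add_apply, LinearMap.smul_apply, smul_eq_mul, ha,
      hu, heξ]
    ring
  have hpp : B p p = l ^ 2 * a + B u u := by
    rw [hp']
    simp only [map_add, map_smul, LinearMap.add_apply, LinearMap.smul_apply, smul_eq_mul, ha,
      hu, huξ]
    ring
  -- signs
  have hα_pos : 0 < α := by
    rw [hα, hB ν ξ]
    exact div_pos_of_neg_of_neg hco hξ
  have huu : 0 ≤ B u u := hsig u hu
  have hee : B e e ≤ α ^ 2 * (-a) := by
    have h := hν
    rw [hν'] at h
    simp only [map_add, map_smul, LinearMap.add_apply, LinearMap.smul_apply, smul_eq_mul, ha,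
      he, heξ] at h
    nlinarith [h]
  have hCS := sq_bilin_le_of_orthogonal B hB ξ hsig hu he
  have hm : B u e ^ 2 ≤ α ^ 2 * (-a) * B u u := by
    calc B u e ^ 2 ≤ B u u * B e e := hCS
      _ ≤ B u u * (α ^ 2 * (-a)) := mul_le_mul_of_nonneg_left hee huu
      _ = α ^ 2 * (-a) * B u u := by ring
  have heu : B e u = B u e := hB e u
  -- the value of `T`
  have hT : B ν p * B ξ p - 2⁻¹ * B ν ξ * B p p =
      α * l ^ 2 * a ^ 2 / 2 + l * a * B u e + α * (-a) * B u u / 2 := by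
    rw [hνp, hξp, hνξ, hpp, heu]
    ring
  rw [hT]
  have h2 : 0 ≤ 2 * α * (α * l ^ 2 * a ^ 2 / 2 + l * a * B u e + α * (-a) * B u u / 2) := by
    nlinarith [sq_nonneg (α * l * a + B u e), hm]
  nlinarith [h2, hα_pos]

/-- **The signature hypothesis is independent of the time axis.** If `B` is symmetric and
positive semidefinite on `ξ^⊥` for some covector `ξ`, and `ξ'` is a timelike covector
(`B(ξ', ξ') < 0`), then `B` is positive semidefinite on `ξ'^⊥` as well (otherwise `span{ξ', u}`
would be a two-dimensional negative definite subspace meeting the hyperplane `ξ^⊥`; Sylvester's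
law of inertia — no sign condition on `B(ξ, ξ)` is needed). [folklore] -/
theorem nonneg_on_orthogonal_of_timelike (B : LinearMap.BilinForm ℝ V) (hB : ∀ u v, B u v = B v u)
    {ξ ξ' : V} (hsig : ∀ u, B ξ u = 0 → 0 ≤ B u u) (hξ' : B ξ' ξ' < 0) :
    ∀ u, B ξ' u = 0 → 0 ≤ B u u := by
  intro u hu
  by_contra hneg
  rw [not_le] at hneg
  -- the vector `v = B(ξ,u) ξ' − B(ξ,ξ') u` is orthogonal to `ξ`
  have hv : B ξ (B ξ u • ξ' - B ξ ξ' • u) = 0 := by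
    rw [map_sub, map_smul, map_smul, smul_eq_mul, smul_eq_mul]
    ring
  have hvv := hsig _ hv
  have huξ' : B u ξ' = 0 := by rw [hB]; exact hu
  simp only [map_sub, map_smul, LinearMap.sub_apply, LinearMap.smul_apply, smul_eq_mul, hu,
    huξ'] at hvv
  -- `B(v,v) = B(ξ,u)² B(ξ',ξ') + B(ξ,ξ')² B(u,u) ≤ 0`, with equality only if both coefficients
  -- vanish; but then `ξ = cξ' + …` forces a contradiction with `B(ξ,ξ) < 0`:
  have h1 : B ξ u = 0 ∧ B ξ ξ' = 0 := by
    constructor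
    · by_contra h
      have : 0 < B ξ u ^ 2 := by positivity
      nlinarith [hvv, sq_nonneg (B ξ ξ'), mul_pos this (neg_pos.mpr hξ')]
    · by_contra h
      have : 0 < B ξ ξ' ^ 2 := by positivity
      nlinarith [hvv, sq_nonneg (B ξ u), mul_pos this (neg_pos.mpr hneg)]
  -- now `ξ' ⊥ ξ` and `u ⊥ ξ`, so `B ≥ 0` on both: contradiction with `B(ξ',ξ') < 0`
  have := hsig ξ' h1.2
  linarith

end Bilin

/-! ### The flux of a multiplier current through a conormal -/

/-- The symmetric bilinear form of a symmetric coefficient matrix: `B(u, v) = ∑_{αβ} g^{αβ} u_α v_β`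
is symmetric. [folklore] -/
theorem toBilin'_symm (g : Fin 4 → Fin 4 → ℝ) (hg : ∀ μ ν, g μ ν = g ν μ) (u v : Fin 4 → ℝ) :
    Matrix.toBilin' g u v = Matrix.toBilin' g v u := by
  rw [Matrix.toBilin'_apply, Matrix.toBilin'_apply, Finset.sum_comm]
  refine Finset.sum_congr rfl fun i _ ↦ Finset.sum_congr rfl fun j _ ↦ ?_
  rw [hg j i]
  ring

/-- **The flux of `J^X` through a conormal `ν` is the stress–energy form `T(ν♯, ξ♯)`**: if the
multiplier is the metric dual of a covector at `x`, `X^α(x) = ∑_β G^{αβ}(x) ξ_β`, then with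
`B = G(x)` (as a bilinear form on covectors) and `p = dw(x)`,
`∑_μ (J^X)^μ ν_μ = B(ν, p) B(ξ, p) − ½ B(ν, ξ) B(p, p)`.
[cite: DafermosRodnianskiShlapentokhrothman2014, §2.3.1] -/
theorem sum_multiplierCurrent_mul_eq {G : E4 → Fin 4 → Fin 4 → ℝ} {X : E4 → Fin 4 → ℝ}
    (w : E4 → ℝ) {x : E4} (hsymm : ∀ μ ν, G x μ ν = G x ν μ) {ξ : Fin 4 → ℝ}
    (hX : ∀ α, X x α = ∑ β, G x α β * ξ β) (ν : Fin 4 → ℝ) :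
    ∑ μ, multiplierCurrent G X w x μ * ν μ =
      Matrix.toBilin' (G x) ν (fun κ ↦ fderiv ℝ w x (E4.basisVector κ)) *
          Matrix.toBilin' (G x) ξ (fun κ ↦ fderiv ℝ w x (E4.basisVector κ)) -
        2⁻¹ * Matrix.toBilin' (G x) ν ξ *
          Matrix.toBilin' (G x) (fun κ ↦ fderiv ℝ w x (E4.basisVector κ))
            (fun κ ↦ fderiv ℝ w x (E4.basisVector κ)) := by
  -- name the atoms and expand everything over `Fin 4`
  obtain ⟨p, hp⟩ : ∃ p : Fin 4 → ℝ, ∀ κ, fderiv ℝ w x (E4.basisVector κ) = p κ := ⟨_, fun _ ↦ rfl⟩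
  simp only [multiplierCurrent, Matrix.toBilin'_apply, hX, hp]
  have g10 := hsymm 1 0; have g20 := hsymm 2 0; have g30 := hsymm 3 0
  have g21 := hsymm 2 1; have g31 := hsymm 3 1; have g32 := hsymm 3 2
  simp only [Fin.sum_univ_four, Fin.isValue]
  rw [g10, g20, g30, g21, g31, g32]
  ring

/-- **The dominant energy condition for multiplier currents.** Let `G` be symmetric at `x`, with
`G(ξ, ξ) < 0` and `G(x) ≥ 0` on `ξ^⊥` for the covector `ξ` whose metric dual is the multiplier,
`X^α(x) = ∑_β G^{αβ}(x) ξ_β` (i.e. `X(x)` is timelike), and let `ν` be a causal covector in the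
cone of `ξ`: `G(ν, ν) ≤ 0`, `G(ξ, ν) = ν(X) < 0`. Then `0 ≤ ∑_μ (J^X)^μ(x) ν_μ` — the flux of the
`X`-current through a hypersurface element with causal conormal `ν` has a sign (Hawking–Ellis
1973, §4.3; the signs of `J^N_μ n^μ` on `Σ_τ` and `𝓗⁺` in DRSR arXiv:1402.7034, §2.3.2).
[cite: HawkingEllis1973CUP, §4.3] -/
theorem sum_multiplierCurrent_mul_nonneg {G : E4 → Fin 4 → Fin 4 → ℝ} {X : E4 → Fin 4 → ℝ}
    (w : E4 → ℝ) {x : E4} (hsymm : ∀ μ ν, G x μ ν = G x ν μ) {ξ : Fin 4 → ℝ}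
    (hX : ∀ α, X x α = ∑ β, G x α β * ξ β) (hξ : Matrix.toBilin' (G x) ξ ξ < 0)
    (hsig : ∀ u, Matrix.toBilin' (G x) ξ u = 0 → 0 ≤ Matrix.toBilin' (G x) u u)
    {ν : Fin 4 → ℝ} (hν : Matrix.toBilin' (G x) ν ν ≤ 0) (hco : Matrix.toBilin' (G x) ξ ν < 0) :
    0 ≤ ∑ μ, multiplierCurrent G X w x μ * ν μ := by
  rw [sum_multiplierCurrent_mul_eq w hsymm hX ν]
  exact dec_bilin _ (toBilin'_symm (G x) hsymm) ξ ν _ hξ hsig hν hco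

/-- **The energy of a timelike multiplier through a co-oriented causal conormal is non-negative**:
under the hypotheses of `sum_multiplierCurrent_mul_nonneg` but with `n` in the *opposite* covector
cone, `G(ξ, n) = n(X) > 0` (e.g. `X` future timelike and `n = dt − dF` the conormal of a spacelike
or null graph `{t = τ + F}`, `G(n, n) ≤ 0`), `0 ≤ −∑_μ (J^X)^μ(x) n_μ` — the energy density
`J^X_μ n^μ_Σ ≥ 0` of DRSR arXiv:1402.7034, §2.3.2, in the raised-index bookkeeping of
`KerrSchild.multiplierCurrent` (cf. `Kerr.graphFluxDensity`). [cite: HawkingEllis1973CUP, §4.3] -/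
theorem neg_sum_multiplierCurrent_mul_nonneg {G : E4 → Fin 4 → Fin 4 → ℝ} {X : E4 → Fin 4 → ℝ}
    (w : E4 → ℝ) {x : E4} (hsymm : ∀ μ ν, G x μ ν = G x ν μ) {ξ : Fin 4 → ℝ}
    (hX : ∀ α, X x α = ∑ β, G x α β * ξ β) (hξ : Matrix.toBilin' (G x) ξ ξ < 0)
    (hsig : ∀ u, Matrix.toBilin' (G x) ξ u = 0 → 0 ≤ Matrix.toBilin' (G x) u u)
    {n : Fin 4 → ℝ} (hn : Matrix.toBilin' (G x) n n ≤ 0) (hco : 0 < Matrix.toBilin' (G x) ξ n) :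
    0 ≤ -∑ μ, multiplierCurrent G X w x μ * n μ := by
  have h := sum_multiplierCurrent_mul_nonneg w hsymm hX hξ hsig (ν := -n)
    (by simpa using hn) (by simpa using hco)
  simpa [Finset.sum_neg_distrib] using h

/-! ### Generalised Kerr–Schild backgrounds satisfy the signature hypothesis -/

namespace Background

/-- On a background, `G(dt, dt) = g^{00} = −(1 + φ) < 0`: `dt` is a timelike covector.
[cite: KerrSchild1965, §2] -/
theorem toBilin'_inverseMetric_dt_dt (B : Background) (x : E4) :
    Matrix.toBilin' (B.inverseMetric x) (fun α ↦ if α = 0 then (1 : ℝ) else 0)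
        (fun α ↦ if α = 0 then (1 : ℝ) else 0) = -(1 + B.φ x) := by
  have hl0 : B.φ x = 0 ∨ B.l x 0 = -1 := by
    by_cases hx : B.φ x = 0
    · exact Or.inl hx
    · right
      have hnorm := B.normalised x hx
      rw [Minkowski.bilin_symm, Minkowski.bilin_basisVector_zero_left] at hnorm
      linarith
  simp only [Matrix.toBilin'_apply, Background.inverseMetric, KerrSchild.inverseMetric,
    Kerr.etaComp, Fin.sum_univ_four, Fin.isValue]
  simp only [show (1 : Fin 4) ≠ 0 from by decide, show (2 : Fin 4) ≠ 0 from by decide,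
    show (3 : Fin 4) ≠ 0 from by decide, if_true, if_false]
  rcases hl0 with h | h
  · rw [h]; ring
  · rw [h]; ring

/-- `dt` is timelike on a background: `G(dt, dt) < 0`. [cite: KerrSchild1965, §2] -/
theorem toBilin'_inverseMetric_dt_dt_neg (B : Background) (x : E4) :
    Matrix.toBilin' (B.inverseMetric x) (fun α ↦ if α = 0 then (1 : ℝ) else 0)
        (fun α ↦ if α = 0 then (1 : ℝ) else 0) < 0 := by
  rw [toBilin'_inverseMetric_dt_dt]
  linarith [B.φ_nonneg x]

/-- **Backgrounds have Lorentzian cone structure with time axis `dt`**: `G ≥ 0` on `dt^⊥`.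
With `g⁻¹ = η⁻¹ − φ ℓ♯ ⊗ ℓ♯`, `ℓ⁰ = −1`, `|ℓ⃗| = 1`, `s = ℓ♯(u) = −u₀ + ℓ⃗·u⃗`: `G(dt, u) = 0` reads
`u₀ = φ s`, hence `ℓ⃗·u⃗ = (1 + φ) s`, and `G(u, u) = −u₀² + |u⃗|² − φ s² ≥ −φ²s² + (1 + φ)²s² − φs²
= (1 + φ) s² ≥ 0` by Cauchy–Schwarz `|u⃗|² ≥ (ℓ⃗·u⃗)²`. [cite: KerrSchild1965, §2] -/
theorem toBilin'_inverseMetric_nonneg_of_orthogonal_dt (B : Background) (x : E4)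
    (u : Fin 4 → ℝ)
    (hu : Matrix.toBilin' (B.inverseMetric x) (fun α ↦ if α = 0 then (1 : ℝ) else 0) u = 0) :
    0 ≤ Matrix.toBilin' (B.inverseMetric x) u u := by
  have hl : B.φ x = 0 ∨ (B.l x 0 = -1 ∧ B.l x 1 ^ 2 + B.l x 2 ^ 2 + B.l x 3 ^ 2 = 1) := by
    by_cases hx : B.φ x = 0
    · exact Or.inl hx
    · right
      have hnorm := B.normalised x hx
      have hnull := B.null x hx
      rw [Minkowski.bilin_symm, Minkowski.bilin_basisVector_zero_left] at hnorm
      have h0 : B.l x 0 = -1 := by linarith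
      refine ⟨h0, ?_⟩
      simp only [Minkowski.bilin_apply, Fin.sum_univ_three, Fin.isValue, Fin.succ_zero_eq_one,
        Fin.succ_one_eq_two, h0] at hnull
      have h3 : (Fin.succ 2 : Fin 4) = 3 := rfl
      rw [h3] at hnull
      nlinarith [hnull]
  -- name the atoms
  obtain ⟨u0, hu0⟩ : ∃ u0, u 0 = u0 := ⟨_, rfl⟩
  obtain ⟨u1, hu1⟩ : ∃ u1, u 1 = u1 := ⟨_, rfl⟩
  obtain ⟨u2, hu2⟩ : ∃ u2, u 2 = u2 := ⟨_, rfl⟩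
  obtain ⟨u3, hu3⟩ : ∃ u3, u 3 = u3 := ⟨_, rfl⟩
  obtain ⟨l0, hl0'⟩ : ∃ l0, B.l x 0 = l0 := ⟨_, rfl⟩
  obtain ⟨l1, hl1⟩ : ∃ l1, B.l x 1 = l1 := ⟨_, rfl⟩
  obtain ⟨l2, hl2⟩ : ∃ l2, B.l x 2 = l2 := ⟨_, rfl⟩
  obtain ⟨l3, hl3⟩ : ∃ l3, B.l x 3 = l3 := ⟨_, rfl⟩
  obtain ⟨f, hf⟩ : ∃ f, B.φ x = f := ⟨_, rfl⟩
  have hf0 : 0 ≤ f := hf ▸ B.φ_nonneg x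
  rw [hf, hl0', hl1, hl2, hl3] at hl
  simp only [Matrix.toBilin'_apply, Background.inverseMetric, KerrSchild.inverseMetric,
    Kerr.etaComp, Fin.sum_univ_four, Fin.isValue, hu0, hu1, hu2, hu3, hl0', hl1, hl2, hl3,
    hf] at hu ⊢
  simp only [show (1 : Fin 4) ≠ 0 from by decide, show (2 : Fin 4) ≠ 0 from by decide,
    show (3 : Fin 4) ≠ 0 from by decide, show (0 : Fin 4) ≠ 1 from by decide,
    show (0 : Fin 4) ≠ 2 from by decide, show (0 : Fin 4) ≠ 3 from by decide,
    show (1 : Fin 4) ≠ 2 from by decide, show (1 : Fin 4) ≠ 3 from by decide,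
    show (2 : Fin 4) ≠ 1 from by decide, show (2 : Fin 4) ≠ 3 from by decide,
    show (3 : Fin 4) ≠ 1 from by decide, show (3 : Fin 4) ≠ 2 from by decide,
    if_true, if_false] at hu ⊢
  rcases hl with h | ⟨h0, hsph⟩
  · -- Minkowski: `u₀ = 0` and `G(u,u) = |u⃗|²`
    subst h
    have hu0' : u0 = 0 := by nlinarith [hu]
    subst hu0'
    nlinarith [sq_nonneg u1, sq_nonneg u2, sq_nonneg u3]
  · subst h0
    -- `s = ℓ♯(u) = -u0·(-1)·… `; Cauchy–Schwarz `(l⃗·u⃗)² ≤ |u⃗|²` since `|l⃗| = 1`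
    have hCS : (l1 * u1 + l2 * u2 + l3 * u3) ^ 2 ≤ u1 ^ 2 + u2 ^ 2 + u3 ^ 2 := by
      nlinarith [sq_nonneg (l1 * u2 - l2 * u1), sq_nonneg (l1 * u3 - l3 * u1),
        sq_nonneg (l2 * u3 - l3 * u2), hsph]
    nlinarith [hCS, hu, hf0, sq_nonneg (u0 + (l1 * u1 + l2 * u2 + l3 * u3)),
      mul_nonneg hf0 (sq_nonneg (-u0 + (l1 * u1 + l2 * u2 + l3 * u3)))]

/-- **The dominant energy condition on a background**: for every multiplier which at `x` is the
metric dual of a timelike covector `ξ` in the cone of `dt` or of `−dt` (`G(ξ, ξ) < 0`), and every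
causal conormal `ν` with `ν(X) < 0`, `0 ≤ ∑_μ (J^X)^μ(x) ν_μ`. [cite: HawkingEllis1973CUP, §4.3] -/
theorem sum_multiplierCurrent_mul_nonneg (B : Background) {X : E4 → Fin 4 → ℝ} (w : E4 → ℝ)
    {x : E4} {ξ : Fin 4 → ℝ} (hX : ∀ α, X x α = ∑ β, B.inverseMetric x α β * ξ β)
    (hξ : Matrix.toBilin' (B.inverseMetric x) ξ ξ < 0) {ν : Fin 4 → ℝ}
    (hν : Matrix.toBilin' (B.inverseMetric x) ν ν ≤ 0)
    (hco : Matrix.toBilin' (B.inverseMetric x) ξ ν < 0) :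
    0 ≤ ∑ μ, multiplierCurrent B.inverseMetric X w x μ * ν μ :=
  KerrSchild.sum_multiplierCurrent_mul_nonneg w (B.inverseMetric_symm x) hX hξ
    (nonneg_on_orthogonal_of_timelike _ (toBilin'_symm _ (B.inverseMetric_symm x))
      (B.toBilin'_inverseMetric_nonneg_of_orthogonal_dt x) hξ) hν hco

end Background

end KerrSchild

end Literature.Geometry.Lorentzian
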